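import Summits.QuantumFields.YangMills.Theorems.BalabanUVNodesN09TowerOfForwardLawsOfNumerics
import Summits.QuantumFields.YangMills.Theorems.BalabanUVNodesN09CentralWindowJacobianGraphContinuous
import Literature.MathematicalPhysics.QuantumFieldTheory.Balaban1983to89.B12NodeKnitRecord13SepCoPH

/-!
# NODE N09 [B12] — ROAD A′ RUNS THE (F1) TOWER FROM NUMERICS: N09's analytic inclusion `hreg_j` and (F3)_j for all `j < K`, and dag-n09-w4 g3's Theorem-3 door at the
# Stage-13 record, from the window ∕ margin numerics, [B11]-existence `hsolν`, N07's `hcrit`, (H-U) `hU` (and the door's (181)ˢᵒˡ + [B11] ×3; (I19) is DERIVED from (H-U)) — NO chart, NO socket,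
# NO inversion datum, NO Jacobian letter, NO openness sentence among the hypotheses

Cell `pub-ymgap` (YM-PLAN Track A), width seat `pub-ymgap-dag-n09-w5` g5 (D-0154 ∕ R399 (3a) width seat 5 of node N09), FILE 4; helper of K1⁹
`StabilityBRunRowsAtRecordR13SepCoPHV` = stmt-QuantumFields-27364 (`--supports`, `--as helper`, count-neutral).  [I] = [Balaban1987RG1] (CMP 109).

WHAT.  FILE 3 `…N09TowerOfForwardLawsOfNumerics.hreg_pos_all_of_forwardLaws_of_hsolν_of_numerics` runs road A′'s tower from the FORWARD-LAW PACKAGE of the one-variable (0.4)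
averages on the central `α`-windows — `⟨jac, hjacm, hjaclb, hjacc, hfwd⟩`: jointly measurable densities, UNIFORMLY bounded below on the window graph, continuous on the windows,
with the forward change-of-variables laws — plus numerics + `hsolν hcrit hU hint`.  That package is now the tree's: dag-n09-w6 g4's
`…N09CentralWindowJacobianGraphContinuous.exists_jacobianLetters_record` (dag-n09-w4 g5's 6d₃ `exists_jacobian_forwardLaws_continuousOn` — chart Jacobian of the exponential-chart
model, measurable and positive on the windows — plus JOINT continuity of that Jacobian on the compact window graph and FILE 2's `exists_pos_le_density_of_continuousOn_graph` for the
uniform lower bound), under `0 ≤ α ≤ 1∕24`, `64·α ≤ δ_N`, `157·α < L^{−(d−1)}`, `offCard c∕|Idx| + 150·α < 1`.  THIS FILE plugs it in (one `obtain`) and derives (I19) `hint` from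
(H-U) `hU` (pub-balaban's `integrable_betaInput_TcanOfRecord_of_measurable` ∕ dag-n24-c's `integrable_betaInput_stage13_of_measurableUk`: a `[0,1]`-valued measurable cut-off on a finite
measure space).

WHAT IS PROVED (theorems only; 0 def, 0 instance, 0 notation, 0 sorry).  `lt_deltaSU_of_sixtyfour_mul_le` · ★★★ `hreg_pos_all_of_hsolν_of_numerics` (generic Stage-13 parameter,
torus, history) · ★★★ `thm3Member_stage13SepCoPH_atDomAlt_of_hsolν_of_numerics_of_εreg_eq` (at the Stage-13 record: dag-n09-w4 g3's
`…N09B0RiderAtRecord.thm3Member_stage13SepCoPH_atDomAlt_of_numerics_of_εreg_eq` with `hreg` AND (I19) DISCHARGED down to numerics + `hsolν hcrit hU`).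

DISPLAYED (what N09's `hreg` costs after this file — every item another lane's currency or a number): the window ∕ margin numerics above + the STRICT margin
`(((d+2)L)²∕4)·ε₀ < α` + dag-n09-w4 g3's seven + `0 ≤ ε₀` + `((d·L)²∕4)·ε₀ < δ_Fed`; [B11]-existence `hsolν` on the domains; N07's `hcrit` ([B11] Thm 1 for a continuous selector of the
critical configuration); (H-U) `hU` (a measurable selection of minimisers) — (I19) is no longer displayed (derived from `hU`); for the door also
(181)ˢᵒˡ `hcov` and [B11] ×3 at `εbg` (`h11 hres huniq`), `εreg = εbg`.

HONEST FRAMING.  A COMPOSITION BY NAME (count-neutral); nothing of Bałaban's ESTIMATES asserted by this seat — the analysis consumed lives in the cited files of dag-n09-w1∕w3∕w4∕w6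
and N07's lanes, the [B11] ∕ N07 ∕ (H-U) ∕ (I19) letters and the numerics are DISPLAYED, asserted of NO record; `hreg` is RE-SHAPED to those letters, NOT discharged at the record
(no numerics row of record is claimed to meet the window conditions); N09 NOT discharged; conjunct 1 (Lemma 4) and FLAG №7 untouched; K0⁷ ∕ K1⁹ ∕ K3⁸ NOT closed; counts unmoved
(typed 28∕28 · discharged 5∕28); no summit statement is proved by this seat; one finite four-torus programme at fixed `ε = L^{−K}` per run — R4 closes the conditional rung
`BalabanLadder.UV` only; NOT continuum ∕ ℝ⁴ ∕ infinite volume ∕ OS; the Yang–Mills mass gap (Clay) is NOT proved by any of this.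
-/

noncomputable section

namespace Summit.QuantumFields.YangMills.BalabanUVNodes.N09TowerOfNumericsAtRecord

open MeasureTheory Set Function Filter Topology
open scoped ENNReal NNReal
open Literature.MathematicalPhysics.QuantumFieldTheory.Balaban1983to89
open Literature.MathematicalPhysics.QuantumFieldTheory.Balaban1983to89.T4Continuum (T4Family)
open Literature.MathematicalPhysics.QuantumFieldTheory.Balaban1983to89.Node00
open Literature.MathematicalPhysics.QuantumFieldTheory.Balaban1983to89.ExpMeanLog (deltaSU deltaSU_pos)
open Literature.MathematicalPhysics.QuantumFieldTheory.Balaban1983to89.FederbushMean (deltaFed)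
open Literature.MathematicalPhysics.QuantumFieldTheory.Balaban1983to89.BlockAveraging (Idx)
open Literature.MathematicalPhysics.QuantumFieldTheory.Balaban1983to89.BlockAveragingHaarAC (centralBond pre post)
open Literature.MathematicalPhysics.QuantumFieldTheory.Balaban1983to89.BlockAveragingEMLHaarAC (fibreFamily offCard)
open Literature.MathematicalPhysics.QuantumFieldTheory.Balaban1983to89.DagBinding (WorldP leavesP)
open Literature.MathematicalPhysics.QuantumFieldTheory.Balaban1983to89.B12RTGaugeInvariance254 (liftTransf)
open Literature.MathematicalPhysics.QuantumFieldTheory.Balaban1983to89.GaugeField (gaugeAct)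
open N09TowerOfForwardLawsOfNumerics (hreg_pos_all_of_forwardLaws_of_hsolν_of_numerics)
open N09CentralWindowJacobianGraphContinuous (exists_jacobianLetters_record)
open N09B0RiderAtRecord (thm3Member_stage13SepCoPH_atDomAlt_of_numerics_of_εreg_eq)
open Literature.MathematicalPhysics.QuantumFieldTheory.Balaban1983to89.B12NodeKnitRecord13SepCoPH
  (integrable_betaInput_TcanOfRecord_of_measurable integrable_betaInput_stage13_of_measurableUk)

variable {F : T4Family} {N : ℕ} [NeZero N]

/-! ## §1  The tower from numerics; §2 the record door -/

/-- `0 ≤ α` and `64·α ≤ δ_N` give `α < δ_N` (`δ_N > 0`, `N ≠ 0`). [cite: Balaban1987RG1, (0.4) p.253 (bookkeeping)] -/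
theorem lt_deltaSU_of_sixtyfour_mul_le {α : ℝ} (hα0 : 0 ≤ α) (hα64 : 64 * α ≤ deltaSU (Fin N)) : α < deltaSU (Fin N) := by
  rcases hα0.eq_or_lt with h | h
  · rw [← h]; exact deltaSU_pos
  · linarith

/-- ★★★ **ROAD A′ RUNS THE (F1) REGULARITY TOWER FROM NUMERICS, [B11]-EXISTENCE, N07, (H-U) AND (I19) ALONE.**  At a Stage-13 parameter `θ₀`, torus `K`, history `g`, radius `α` with
`0 ≤ α ≤ 1∕24`, `64·α ≤ δ_N`, `157·α < L^{−(d−1)}`, `offCard c∕|Idx| + 150·α < 1`, the STRICT margin `(((d+2)L)²∕4)·ε₀ < α`, dag-n09-w4 g3's numerics, `0 ≤ ε₀`, `((d·L)²∕4)·ε₀ < δ_Fed`,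
[B11]-existence `hsolν`, N07's `hcrit`, (H-U) `hU` ((I19) derived): for every `j < K`, `domAlt_{j+1} ⊆ regSetOfRecord K j ρ_j` (N09's `hreg_j`) and `T_jρ_j > 0` on `domAlt_{j+1}` ((F3)_j).
FILE 3 with its forward-law package `⟨jac, hjacm, hjaclb, hjacc, hfwd⟩ :=` dag-n09-w6 g4's `exists_jacobianLetters_record` (dag-n09-w4 g5's `exists_jacobian_forwardLaws_continuousOn` + joint
continuity of the chart Jacobian on the compact window graph + FILE 2's `exists_pos_le_density_of_continuousOn_graph`).  NO chart, NO socket, NO inversion datum, NO density, NO openness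
sentence, NO integrability letter is a hypothesis any more.  CONDITIONAL on the displayed numerics + `hsolν hcrit hU`; nothing of Bałaban's ESTIMATES asserted; no numerics row of record is
claimed to meet the window conditions.
[cite: Balaban1987RG1, p.259, (0.4) p.253, (0.19) p.255, (2.3)–(2.4) pp.265–266 and (2.9)–(2.10) pp.266–267; Balaban1985Averaging, (19) p.21, Prop. 2 (53) p.26 and Prop. 3 (124) p.36; Balaban1985Variational, Thm 1 (8)–(10) p.279; Kechris1995, Thm 15.1 and Cor 15.2; Helgason2000, Ch. I §1 Thm. 1.14 (12)-(13) p. 96] -/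
theorem hreg_pos_all_of_hsolν_of_numerics (θ₀ : Stage13Params F N) (K : ℕ) (g : ℕ → ℝ) {α : ℝ} (hα0 : 0 ≤ α) (hα24 : α ≤ 1 / 24)
    (hα64 : 64 * α ≤ deltaSU (Fin N)) (hαL : 157 * α < ((((F.P K).L : ℝ)) ^ ((F.P K).d - 1))⁻¹)
    (hgap : ∀ j < K, ∀ c : PBond (F.P K) (j + 1), (offCard c : ℝ) / (Fintype.card (Idx (F.P K)) : ℝ) + 150 * α < 1)
    (hεreg : 0 < θ₀.ν.εreg)
    (hε3 : (143 * (((((F.P K).d + 4 : ℕ) : ℝ)) ^ 2 / 4) ^ 2) * θ₀.ν.εreg ≤ 1 / 3)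
    (hε2 : 2 * θ₀.ν.εreg ≤ 2 * deltaSU (Fin N) / ((((F.P K).d + 4) * (F.P K).L : ℕ) : ℝ) ^ 2) (hε29 : 0 < θ₀.ε₂₉)
    (hn1 : 1640 * (2 * (((((F.P K).d + 2) * (F.P K).L : ℕ) : ℝ) * θ₀.ε₂₉) +
        ((((F.P K).d + 2) * (F.P K).L : ℕ) : ℝ) ^ 2 / 4 * (2 * θ₀.ν.εreg / ((F.P K).L : ℝ) ^ 2)) * (((F.P K).L : ℝ) ^ ((F.P K).d - 1)) ^ 2 ≤ 1)
    (hn2 : 13 * (2 * (((((F.P K).d + 2) * (F.P K).L : ℕ) : ℝ) * θ₀.ε₂₉) +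
        ((((F.P K).d + 2) * (F.P K).L : ℕ) : ℝ) ^ 2 / 4 * (2 * θ₀.ν.εreg / ((F.P K).L : ℝ) ^ 2)) * ((F.P K).L : ℝ) ^ ((F.P K).d - 1) < deltaSU (Fin N))
    (hord : 2 * θ₀.ν.εreg / ((F.P K).L : ℝ) ^ 2 +
      4 * max θ₀.ε₂₉ (10 * (((((F.P K).d + 2) * (F.P K).L : ℕ) : ℝ) * θ₀.ε₂₉) * ((F.P K).L : ℝ) ^ ((F.P K).d - 1)) ≤ θ₀.ν.ε₀)
    (hα : ((((F.P K).d + 2) * (F.P K).L : ℕ) : ℝ) ^ 2 / 4 * θ₀.ν.ε₀ < α)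
    (hε₀ : 0 ≤ θ₀.ν.ε₀) (hnumF : ((((F.P K).d * (F.P K).L : ℕ) : ℝ)) ^ 2 / 4 * θ₀.ν.ε₀ < deltaFed (Fin N))
    (hsolν : ∀ j < K, ∀ W ∈ domAltOfRecord F N θ₀.ν K (j + 1), UkExists F N K (j + 1) θ₀.ν.εreg W)
    (hU : ∀ k, Measurable (Uk F N K (k + 1) θ₀.ν.εreg))
    (hcrit : ∀ j < K, ContinuousOn (critCfgOfRecord F N θ₀.ν K j) (domAltOfRecord F N θ₀.ν K (j + 1))) :
    ∀ j < K, domAltOfRecord F N θ₀.ν K (j + 1) ⊆ regSetOfRecord F N K j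
        (betaInputOfRecord F N (TcanOfRecord F N) (chiFixed29 F N θ₀.ν θ₀.ε₂₉) K g j) ∧
      ∀ V ∈ domAltOfRecord F N θ₀.ν K (j + 1),
        0 < TcanOfRecord F N K j (betaInputOfRecord F N (TcanOfRecord F N) (chiFixed29 F N θ₀.ν θ₀.ε₂₉) K g j) V := by
  obtain ⟨jac, hjacm, hjaclb, hjacc, hfwd⟩ := exists_jacobianLetters_record (F := F) (N := N) K hα0 hα24 hα64 hαL hgap
  -- (I19) from (H-U): the β-input is a bounded measurable function on a finite measure space once the (2.9) cut-off is measurable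
  have hint : ∀ j < K, Integrable (betaInputOfRecord F N (TcanOfRecord F N) (chiFixed29 F N θ₀.ν θ₀.ε₂₉) K g j) (fieldMeasure (F.P K) j (SU N)) :=
    fun j hj => integrable_betaInput_TcanOfRecord_of_measurable F N (chiFixed29 F N θ₀.ν θ₀.ε₂₉) K g
      (fun k _ => measurable_chiFix29OfRecord_of θ₀.ε₂₉ (hU k)) (fun k U => (chiFix29OfRecord_mem_Icc θ₀.ν θ₀.ε₂₉ K k U).1)
      (fun k U => (chiFix29OfRecord_mem_Icc θ₀.ν θ₀.ε₂₉ K k U).2) j hj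
  exact hreg_pos_all_of_forwardLaws_of_hsolν_of_numerics θ₀ K g hα0 hα24 (lt_deltaSU_of_sixtyfour_mul_le hα0 hα64) hαL hgap jac hjacm hjaclb hjacc hfwd
    hεreg hε3 hε2 hε29 hn1 hn2 hord hα hε₀ hnumF hsolν hU hint hcrit

section RecordNumerics

variable (θ : Stage13HParams F N) (h : θ.Provisos₁₃SepCoPH F N) {w : WorldP} (P : B12.RunParams)

/-- ★★★ **N09's THEOREM-3 MEMBER AT THE STAGE-13 RECORD FROM NUMERICS, (181)ˢᵒˡ, [B11] ×3, N07, (H-U)** (dag-n09-w4 g3's door with `hreg` := the tower from numerics at the record and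
`hint` := `integrable_betaInput_stage13_of_measurableUk`): NO `hreg`, NO `hint`, NO chart, NO socket, NO inversion datum, NO Jacobian letter among the hypotheses.  CONDITIONAL; nothing of Bałaban's estimates asserted; N09 NOT discharged (the [B11] ∕ N07 ∕ (H-U) ∕ (I19) letters
and the numerics are of NO record here). [cite: Balaban1987RG1, Thm 3 p.264, p.259, (0.4) p.253, (0.17)–(0.19) p.255, (2.9)–(2.10) pp.266–267; Balaban1985Variational, Thm 1 (8)–(10) p.279 and (181) p.307; Balaban1985Averaging, Prop. 2 (53) p.26 and Prop. 3 (124) p.36] -/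
theorem thm3Member_stage13SepCoPH_atDomAlt_of_hsolν_of_numerics_of_εreg_eq
    (hC : w.C = (datumOfRecord₁₃SepCoPH F N θ h).C) (heq : θ.toStage13Params.ν.εreg = θ.εbg) {α : ℝ} (hα0 : 0 ≤ α) (hα24 : α ≤ 1 / 24)
    (hα64 : 64 * α ≤ deltaSU (Fin N)) (hαL : 157 * α < ((((F.P P.K).L : ℝ)) ^ ((F.P P.K).d - 1))⁻¹)
    (hgap : ∀ j < P.K, ∀ c : PBond (F.P P.K) (j + 1), (offCard c : ℝ) / (Fintype.card (Idx (F.P P.K)) : ℝ) + 150 * α < 1)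
    (hεreg : 0 < θ.toStage13Params.ν.εreg)
    (hε3 : (143 * (((((F.P P.K).d + 4 : ℕ) : ℝ)) ^ 2 / 4) ^ 2) * θ.toStage13Params.ν.εreg ≤ 1 / 3)
    (hε2 : 2 * θ.toStage13Params.ν.εreg ≤ 2 * deltaSU (Fin N) / ((((F.P P.K).d + 4) * (F.P P.K).L : ℕ) : ℝ) ^ 2) (hε29 : 0 < θ.toStage13Params.ε₂₉)
    (hn1 : 1640 * (2 * (((((F.P P.K).d + 2) * (F.P P.K).L : ℕ) : ℝ) * θ.toStage13Params.ε₂₉) +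
        ((((F.P P.K).d + 2) * (F.P P.K).L : ℕ) : ℝ) ^ 2 / 4 * (2 * θ.toStage13Params.ν.εreg / ((F.P P.K).L : ℝ) ^ 2)) * (((F.P P.K).L : ℝ) ^ ((F.P P.K).d - 1)) ^ 2 ≤ 1)
    (hn2 : 13 * (2 * (((((F.P P.K).d + 2) * (F.P P.K).L : ℕ) : ℝ) * θ.toStage13Params.ε₂₉) +
        ((((F.P P.K).d + 2) * (F.P P.K).L : ℕ) : ℝ) ^ 2 / 4 * (2 * θ.toStage13Params.ν.εreg / ((F.P P.K).L : ℝ) ^ 2)) * ((F.P P.K).L : ℝ) ^ ((F.P P.K).d - 1) < deltaSU (Fin N))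
    (hord : 2 * θ.toStage13Params.ν.εreg / ((F.P P.K).L : ℝ) ^ 2 +
      4 * max θ.toStage13Params.ε₂₉ (10 * (((((F.P P.K).d + 2) * (F.P P.K).L : ℕ) : ℝ) * θ.toStage13Params.ε₂₉) * ((F.P P.K).L : ℝ) ^ ((F.P P.K).d - 1)) ≤
        θ.toStage13Params.ν.ε₀)
    (hα : ((((F.P P.K).d + 2) * (F.P P.K).L : ℕ) : ℝ) ^ 2 / 4 * θ.toStage13Params.ν.ε₀ < α)
    (hε₀ : 0 ≤ θ.toStage13Params.ν.ε₀) (hnumF : ((((F.P P.K).d * (F.P P.K).L : ℕ) : ℝ)) ^ 2 / 4 * θ.toStage13Params.ν.ε₀ < deltaFed (Fin N))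
    (hcov : ∀ j < P.K, ∀ (v : GaugeTransf (F.P P.K) (j + 1) (SU N)) (W : GaugeField (F.P P.K) (j + 1) (SU N)),
      UkExists F N P.K (j + 1) θ.toStage13Params.ν.εreg W →
        critCfgOfRecord F N θ.toStage13Params.ν P.K j (gaugeAct v W) = gaugeAct (liftTransf v) (critCfgOfRecord F N θ.toStage13Params.ν P.K j W))
    (hsolν : ∀ j < P.K, ∀ W ∈ domAltOfRecord F N θ.ν P.K (j + 1), UkExists F N P.K (j + 1) θ.toStage13Params.ν.εreg W)
    (hU : ∀ k, Measurable (Uk F N P.K (k + 1) θ.toStage13Params.ν.εreg))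
    (hcrit : ∀ j < P.K, ContinuousOn (critCfgOfRecord F N θ.toStage13Params.ν P.K j) (domAltOfRecord F N θ.ν P.K (j + 1)))
    (h11 : ∀ k, k ≤ P.K → ∀ V ∈ domAltOfRecord F N θ.ν P.K k, UkExists F N P.K k θ.εbg V ∧ UniqueUkOrbit F N P.K k θ.εbg V)
    (hres : ∀ k, k ≤ P.K → HRestrict F N θ.εbg P.K k (domAltOfRecord F N θ.ν P.K k))
    (huniq : ∀ k, k ≤ P.K → ∀ V ∈ domAltOfRecord F N θ.ν P.K k, ∀ j < k,
      UniqueUkOrbit F N P.K (j + 1) θ.εbg (Averaging.iter (avOfRecord F N P.K) (j + 1) (Uk F N P.K k θ.εbg V))) :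
    (leavesP w P).smallCouplings → (leavesP w P).smallFieldInductive :=
  thm3Member_stage13SepCoPH_atDomAlt_of_numerics_of_εreg_eq θ h hC P hε29 heq hεreg hε3 hε2 hord hn1 hn2 hcov hsolν
    (integrable_betaInput_stage13_of_measurableUk θ.toStage13Params P fun k _ => hU k)
    (fun j hj => (hreg_pos_all_of_hsolν_of_numerics θ.toStage13Params P.K (gOfRecord₁₃ F N θ.toStage13Params P) hα0 hα24 hα64 hαL hgap
      hεreg hε3 hε2 hε29 hn1 hn2 hord hα hε₀ hnumF hsolν hU hcrit j hj).1)
    h11 hres huniq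

end RecordNumerics

end Summit.QuantumFields.YangMills.BalabanUVNodes.N09TowerOfNumericsAtRecord

end
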